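import Mathlib.Analysis.SpecialFunctions.Pow.Real
import Literature.Probability.RandomPlanarGeometry.ConformalRectangle
import Literature.Probability.LatticeModels.IsoradialPercolation
import Literature.Probability.Percolation.FlipResponse
import Summits.CriticalPhenomena.CardyFormulaZ2.Theorems.CardyFlipRussoSquareFromVoronoiHubDefs
import HarnessLib

/-!
# Vocabulary of the bits leg L5 for the kernel crux `QuadrupoleSelectionRule`
# (stmt-CriticalPhenomena-7029, route `CardyFlipRusso`, sub-problem `CardyFormulaZ2`)

DEFINITIONS MODULE (lead `prover-line-stmt-CriticalPhenomena-7029-c2-0`, line `Sketch`,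
generation 4, 2026-08-17).  The kernel crux is INFORMAL (the route file declares no
`QuadrupoleSelectionRule`); the leads' typing recommendation (`Cruxes/QuadrupoleSelectionRule/
Lines/Sketch.md`, drafts `Lines/SketchTypingDraftBits.lean`) is to type it PER LEG in the form the
leg consumes, the bits leg L5 of `SquareFromVoronoiHub` first.  This module puts the objects of
that leg in the tree so that the typed item, the stub files
`Theorems/CardyFlipRussoQuadrupoleSelectionRule*.lean` and the landed transfer theorem
`uniform_close_annealed_flipLeg_of_kernel_bound` can refer to them BY NAME.  Everything is
definitional bookkeeping on `ℤ²` coordinates over tree declarations (`zGs` of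
`CardyFlipRussoSquareFromVoronoiHubDefs`, `flipGraph`/`flipResponse`, `prodBernoulli`,
`sitePercolation`, `siteConnIn`, `ConformalRectangle`); the one combinatorial lemma is
`gamma_insert_eq_flipGraph` (switching the bit of a face IS the diagonal flip at that face).

## The leg (route `CardyFlipRusso`, crux `SquareFromVoronoiHub`, leg L5)

Vertices `V = ℤ² ⊕ (ℤ² + (½,½))` (positions `zGs`); the rotated square grid `Λ` joins every
`ℤ²` point to its four dual neighbours at distance `1/√2`; its faces are rhombi indexed by their
`ℤ²`-diagonal (`Face = (ℤ × ℤ) × Bool`: horizontal edge `x — x+(1,0)` or vertical edge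
`x — x+(0,1)`), the other diagonal being the dual edge through the same midpoint.  The leg graph
`Gamma τ` carries, for every face `k`, its `ℤ²`-diagonal `B k — D k` if `k ∈ τ` and its dual
diagonal `A k — C k` otherwise (`τ = univ`: the centred square lattice `G_s` of the route's
`Target (ii)`; `τ = ∅`: its dual).  Along the leg the bits are i.i.d. with `P(k ∈ τ) = t`
(`legLaw t`), the colours i.i.d. fair (`sitePercolation V half`), and the observable is the
route's crude crossing event of a conformal rectangle at mesh `δ` (`crossingEvent`), read in
the graph frozen to dual diagonals outside a box of faces containing the domain (`GammaMesh`).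

## The kernel on L5 and its two halves

* `QuadrupoleSelectionRuleBits` — the kernel in CONSUMED form: the annealed flip sum
  `flipSum R t δ = Σ_{k ∈ faces R δ} E_t[Δ_k^δ]` (the right-hand side of the landed annealed
  flip–Russo formula `hasDerivWithinAt_annealed_flipLeg`) is `≤ η δ → 0` uniformly in `t`.
* `PairRate θ` — the crux proper, normalisation-free: the responses of the quarter-turn PAIR of
  faces pivoting at a `ℤ²` vertex at depth `d > C₀ δ` cancel to relative order `(δ/d)^θ`
  against their own four-arm weights `armWeight` (`E_t[P(created) + P(destroyed)]`).  Mechanism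
  (informal item, clauses (ii)+(iii)): the spin-2 (stress-tensor) parts of the two responses are
  opposite under the quarter turn and cancel up to the displacement `O(δ/d)`, and every
  role-shift-odd scalar channel is sub-marginal; refutable by Monte Carlo on L5 directly.
* `ArmBudget θ` — the a-priori half: `Σ_faces cutoff · armWeight → 0` uniformly in `t`, where
  `cutoff = 1` in the boundary layer `d ≤ C₀ δ` and `(C₀ δ/d)^θ` beyond (annealed RSW and arm
  estimates along the leg; Köhler-Schindler–Tassion 2023 give RSW for such symmetric laws).

The reduction `PairRate θ → ArmBudget θ → QuadrupoleSelectionRuleBits` and the consumption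
`QuadrupoleSelectionRuleBits → (legProb R · δ uniformly close on [0,1])` are proved in
`Theorems/CardyFlipRussoQuadrupoleSelectionRuleBitsReduction.lean`, not here.
Sources: Beffara, *Is critical 2D percolation universal?* (2008) §2.2, §5.1–5.2 (mixed
square-lattice models, flip/Russo calculus); Bollobás–Riordan, *Percolation* (2006) p. 160
(sheared lattices); Köhler-Schindler–Tassion, Duke Math. J. 172 (2023) Thm 1.
-/

noncomputable section

open MeasureTheory Filter Topology Set
open scoped BigOperators

namespace Summit.CriticalPhenomena.CardyFormulaZ2.Theorems.BitsLeg

open Literature.Probability.LatticeModels Literature.Probability.Percolation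
  Literature.Probability.RandomPlanarGeometry
open Summit.CriticalPhenomena.CardyFormulaZ2.Cruxes.SquareFromVoronoiHub.VoronoiBlocks (zGs)

/-! ### The rotated square grid, its faces and diagonals -/

/-- Vertices of the bits leg: `ℤ²` (left summand) and the dual points `ℤ² + (½, ½)` (right
summand), positioned by `zGs` — the vertex type of the route's `Target (ii)`. [folklore] -/
abbrev V : Type := (ℤ × ℤ) ⊕ (ℤ × ℤ)

/-- Faces of the rotated grid `Λ`, indexed by their `ℤ²`-diagonal: `(x, false)` is the face whose
`ℤ²`-diagonal is the horizontal edge `x — x + (1,0)`, `(x, true)` the one with the vertical edge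
`x — x + (0,1)`. [folklore] -/
abbrev Face : Type := (ℤ × ℤ) × Bool

/-- Corner `B k`: the `ℤ²`-endpoint `x` of the `ℤ²`-diagonal of face `k` (the pivot vertex
shared by the two faces `(x, false)`, `(x, true)`). [folklore] -/
def fB (k : Face) : V := Sum.inl k.1

/-- Corner `D k`: the other `ℤ²`-endpoint (`x + (1,0)` resp. `x + (0,1)`). [folklore] -/
def fD (k : Face) : V := Sum.inl (if k.2 then (k.1.1, k.1.2 + 1) else (k.1.1 + 1, k.1.2))

/-- Corner `A k`: the dual endpoint `x + (½, ½)` of the dual diagonal of face `k` (also shared by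
the two faces pivoting at `x`). [folklore] -/
def fA (k : Face) : V := Sum.inr k.1

/-- Corner `C k`: the other dual endpoint (`x + (½, −½)` resp. `x + (−½, ½)`). [folklore] -/
def fC (k : Face) : V := Sum.inr (if k.2 then (k.1.1 - 1, k.1.2) else (k.1.1, k.1.2 - 1))

/-- The rotated square grid `Λ` (centre-to-corner edges of the centred square lattice): `inl x`
is joined to the four dual points `x + (±½, ±½)`. [folklore] -/
def lamRel : V → V → Prop
  | Sum.inl x, Sum.inr f => (f.1 = x.1 ∨ f.1 = x.1 - 1) ∧ (f.2 = x.2 ∨ f.2 = x.2 - 1)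
  | _, _ => False

/-- `lamRel` only relates a left vertex to a right vertex. [folklore] -/
theorem isLeft_of_lamRel {u v : V} (h : lamRel u v) : u.isLeft = true := by
  cases u <;> cases v <;> simp [lamRel] at h ⊢

/-- An edge with a left endpoint is not a dual diagonal `A k C k`. [folklore] -/
theorem ne_AC_of_isLeft {u v : V} (h : u.isLeft = true ∨ v.isLeft = true) (k : Face) :
    s(u, v) ≠ s(fA k, fC k) := by
  intro heq
  rcases Sym2.eq_iff.1 heq with ⟨h1, h2⟩ | ⟨h1, h2⟩ <;>
    rcases h with h | h <;> simp [h1, h2, fA, fC] at h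

/-- The dual diagonal determines its face. [folklore] -/
theorem eq_of_AC_eq {k k' : Face} (h : s(fA k, fC k) = s(fA k', fC k')) : k = k' := by
  obtain ⟨⟨a, b⟩, e⟩ := k
  obtain ⟨⟨a', b'⟩, e'⟩ := k'
  rcases Sym2.eq_iff.1 h with ⟨h1, h2⟩ | ⟨h1, h2⟩ <;>
    cases e <;> cases e' <;> simp [fA, fC, Prod.ext_iff] at h1 h2 ⊢ <;> omega

/-- Adjacency of **the leg graph** `Γ τ`: `Λ` together with, for every face `k`, its
`ℤ²`-diagonal `B k D k` if `k ∈ τ` and its dual diagonal `A k C k` otherwise (`τ = univ` gives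
the route's `G_s`, `τ = ∅` its dual). [folklore] -/
def gammaAdj (τ : Set Face) (u v : V) : Prop :=
  u ≠ v ∧ (lamRel u v ∨ lamRel v u ∨
    ∃ k : Face, (k ∈ τ ∧ s(u, v) = s(fB k, fD k)) ∨ (k ∉ τ ∧ s(u, v) = s(fA k, fC k)))

/-- `gammaAdj τ` is symmetric. [folklore] -/
theorem gammaAdj_symm (τ : Set Face) {u v : V} (h : gammaAdj τ u v) : gammaAdj τ v u := by
  refine ⟨h.1.symm, ?_⟩
  have hs : s(v, u) = s(u, v) := Sym2.eq_swap
  rcases h.2 with h2 | h2 | ⟨k, hk⟩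
  · exact Or.inr (Or.inl h2)
  · exact Or.inl h2
  · exact Or.inr (Or.inr ⟨k, by rw [hs]; exact hk⟩)

/-- **The leg graph** `Γ τ` as a simple graph. [folklore] -/
def Gamma (τ : Set Face) : SimpleGraph V where
  Adj := gammaAdj τ
  symm := ⟨fun _ _ h => gammaAdj_symm τ h⟩
  loopless := ⟨fun _ h => h.1 rfl⟩

/-- Unfolding lemma for the adjacency of `Γ τ`. [folklore] -/
theorem gamma_adj (τ : Set Face) (u v : V) :
    (Gamma τ).Adj u v ↔ u ≠ v ∧ (lamRel u v ∨ lamRel v u ∨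
      ∃ k : Face, (k ∈ τ ∧ s(u, v) = s(fB k, fD k)) ∨ (k ∉ τ ∧ s(u, v) = s(fA k, fC k))) :=
  Iff.rfl

/-- **Switching the bit of face `k` is the diagonal flip at `k`**: the graph with `k` switched on
is the `flipGraph` (delete `A k C k`, add `B k D k`) of the graph with `k` switched off — the
hypothesis `hflip` of the annealed flip–Russo formula (Beffara 2008 §5.2). [folklore] -/
theorem gamma_insert_eq_flipGraph (τ : Set Face) (k : Face) :
    Gamma (insert k τ) = flipGraph (Gamma (τ \ {k})) (fA k) (fB k) (fC k) (fD k) := by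
  ext u v
  rw [flipGraph_adj, gamma_adj, gamma_adj]
  constructor
  · rintro ⟨hne, h⟩
    rcases h with hl | hl | ⟨k', hk'⟩
    · exact Or.inl ⟨⟨hne, Or.inl hl⟩, ne_AC_of_isLeft (Or.inl (isLeft_of_lamRel hl)) k⟩
    · exact Or.inl ⟨⟨hne, Or.inr (Or.inl hl)⟩, ne_AC_of_isLeft (Or.inr (isLeft_of_lamRel hl)) k⟩
    · rcases hk' with ⟨hmem, heq⟩ | ⟨hnmem, heq⟩
      · by_cases hk : k' = k
        · subst hk
          exact Or.inr ⟨heq.symm, hne⟩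
        · have hτ : k' ∈ τ \ {k} := ⟨(Set.mem_insert_iff.1 hmem).resolve_left hk, hk⟩
          refine Or.inl ⟨⟨hne, Or.inr (Or.inr ⟨k', Or.inl ⟨hτ, heq⟩⟩)⟩, ?_⟩
          rw [heq]
          exact ne_AC_of_isLeft (Or.inl rfl) k
      · have hk : k' ≠ k := fun h => hnmem (h ▸ Set.mem_insert k τ)
        have hτ : k' ∉ τ \ {k} := fun h => hnmem (Set.mem_insert_of_mem k h.1)
        refine Or.inl ⟨⟨hne, Or.inr (Or.inr ⟨k', Or.inr ⟨hτ, heq⟩⟩)⟩, ?_⟩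
        rw [heq]
        exact fun h => hk (eq_of_AC_eq h)
  · rintro (⟨⟨hne, h⟩, hneq⟩ | ⟨heq, hne⟩)
    · rcases h with hl | hl | ⟨k', hk'⟩
      · exact ⟨hne, Or.inl hl⟩
      · exact ⟨hne, Or.inr (Or.inl hl)⟩
      · rcases hk' with ⟨hmem, heq⟩ | ⟨hnmem, heq⟩
        · exact ⟨hne, Or.inr (Or.inr ⟨k', Or.inl ⟨Set.mem_insert_of_mem k hmem.1, heq⟩⟩)⟩
        · by_cases hk : k' = k
          · subst hk
            exact absurd heq hneq
          · have hτ : k' ∉ τ := fun h => hnmem ⟨h, hk⟩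
            exact ⟨hne, Or.inr (Or.inr ⟨k', Or.inr
              ⟨fun h => (Set.mem_insert_iff.1 h).elim hk hτ, heq⟩⟩)⟩
    · exact ⟨hne, Or.inr (Or.inr ⟨k, Or.inl ⟨Set.mem_insert k τ, heq.symm⟩⟩)⟩

/-! ### Mesh, domain, the crude crossing event and the annealed quantities of the leg -/

/-- A radius bounding the (bounded) conformal rectangle. [folklore] -/
theorem exists_norm_le : ∀ R : Literature.Probability.RandomPlanarGeometry.ConformalRectangle, ∃ ρ : ℝ, ∀ w ∈ R.carrier, ‖w‖ ≤ ρ := by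
  intro R
  obtain ⟨ρ, hρ⟩ := R.isBounded.subset_closedBall (0 : ℂ)
  exact ⟨ρ, fun w hw => by simpa using hρ hw⟩

/-- Half-width of a box of faces containing every face that meets `R` at mesh `δ`. [folklore] -/
def boxN (R : ConformalRectangle) (δ : ℝ) : ℕ :=
  ⌈Classical.choose (exists_norm_le R) / δ⌉₊ + 2

/-- The finite box of `ℤ²` pivot vertices read at mesh `δ`. [folklore] -/
def box (R : ConformalRectangle) (δ : ℝ) : Finset (ℤ × ℤ) :=
  Finset.Icc (-(boxN R δ : ℤ)) (boxN R δ) ×ˢ Finset.Icc (-(boxN R δ : ℤ)) (boxN R δ)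

/-- The finite set of faces read at mesh `δ`: both faces of every pivot vertex of the box (faces
outside it are frozen; they never touch the crossing event). [folklore] -/
def faces (R : ConformalRectangle) (δ : ℝ) : Finset Face :=
  box R δ ×ˢ Finset.univ

/-- The leg graph at mesh `δ`: bits outside the box are frozen to "dual diagonal". [folklore] -/
def GammaMesh (R : ConformalRectangle) (δ : ℝ) (τ : Set Face) : SimpleGraph V :=
  Gamma (τ ∩ ↑(faces R δ))

/-- The route's crude crossing event of `R` at mesh `δ` in the graph `G` (open path with all
vertices in `Ω`, endpoints within `2δ` of the arcs `(ab)`, `(cd)`) — verbatim the event of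
`Target (ii)` / `CoveringLeg` (`crudeCrossing` of `CardyFlipRussoSquareFromVoronoiHubDefs` is the
case `G = Gs`), with the graph as a parameter so that flips can act on it. [folklore] -/
def crossingEvent (R : ConformalRectangle) (δ : ℝ) (G : SimpleGraph V) : Set (SiteConfig V) :=
  {ω | ∃ u v, Metric.infDist ((δ : ℂ) * zGs u) (R.arc 0) ≤ 2 * δ ∧
    Metric.infDist ((δ : ℂ) * zGs v) (R.arc 2) ≤ 2 * δ ∧
    ω ∈ siteConnIn G {y | (δ : ℂ) * zGs y ∈ R.carrier} u v}

/-- The law of the diagonal bits at leg parameter `t`: i.i.d., `P(ℤ²-diagonal) = t` (clamped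
to `[0,1]`; the leg of the route is `t ∈ [½, 1]`). [folklore] -/
def legLaw (t : ℝ) : Measure (Set Face) :=
  prodBernoulli fun _ : Face => Set.projIcc 0 1 zero_le_one t

/-- `legLaw t` is a probability measure. [folklore] -/
instance instIsProbabilityMeasureLegLaw (t : ℝ) : IsProbabilityMeasure (legLaw t) := by
  unfold legLaw; infer_instance

/-- The annealed crossing probability along the leg: `E_t[P_½(U_R^δ(Γ^δ τ))]`. [folklore] -/
def legProb (R : ConformalRectangle) (t δ : ℝ) : ℝ :=
  ∫ τ, (sitePercolation V half).real (crossingEvent R δ (GammaMesh R δ τ)) ∂(legLaw t)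

/-- The annealed flip response `E_t[Δ_k^δ]` of face `k` for the crude crossing event of `R` at
mesh `δ` (Beffara 2008 §5.2: the Russo summand of the flip calculus). [folklore] -/
def faceResponse (R : ConformalRectangle) (t δ : ℝ) (k : Face) : ℝ :=
  ∫ τ, flipResponse (GammaMesh R δ (τ \ {k})) (fA k) (fB k) (fC k) (fD k) (crossingEvent R δ) half
    ∂(legLaw t)

/-- The annealed flip sum of the leg at `(t, δ)`: `Σ_{k ∈ faces R δ} E_t[Δ_k^δ]`, the right-hand
side of the annealed flip–Russo formula `hasDerivWithinAt_annealed_flipLeg`. [folklore] -/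
def flipSum (R : ConformalRectangle) (t δ : ℝ) : ℝ :=
  ∑ k ∈ faces R δ, faceResponse R t δ k

/-- The annealed **four-arm weight** of face `k`: `E_t[P(created) + P(destroyed)]`, the two
four-arm-type events of the flip at `k` (the colours of the corners are forced by
`crossing_flipGraph_sdiff_subset` / `crossing_sdiff_flipGraph_subset`; their open arms by
`crossing_flipGraph_sdiff_subset_arms`). [folklore] -/
def armWeight (R : ConformalRectangle) (t δ : ℝ) (k : Face) : ℝ :=
  ∫ τ, ((sitePercolation V half).real
        (crossingEvent R δ (flipGraph (GammaMesh R δ (τ \ {k})) (fA k) (fB k) (fC k) (fD k)) \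
          crossingEvent R δ (GammaMesh R δ (τ \ {k}))) +
      (sitePercolation V half).real
        (crossingEvent R δ (GammaMesh R δ (τ \ {k})) \
          crossingEvent R δ (flipGraph (GammaMesh R δ (τ \ {k})) (fA k) (fB k) (fC k) (fD k))))
    ∂(legLaw t)

/-- The **depth** at mesh `δ` of the quarter-turn pair of faces pivoting at the `ℤ²` vertex `x`:
the distance of `δ x` to the complement of the domain. [folklore] -/
def depth (R : ConformalRectangle) (δ : ℝ) (x : ℤ × ℤ) : ℝ :=
  Metric.infDist ((δ : ℂ) * zGs (Sum.inl x)) R.carrierᶜ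

/-- The cut-off factor of the arm budget: `1` in the boundary layer `d ≤ C₀ δ`, `(C₀ δ / d)^θ`
beyond it (no junk value at `d = 0`). [folklore] -/
def cutoff (C₀ θ δ d : ℝ) : ℝ :=
  if d ≤ C₀ * δ then 1 else (C₀ * δ / d) ^ θ

/-! ### The kernel on L5 (consumed form) and its two halves -/

/-- **The kernel crux on the bits leg, consumed form** (typing draft no. 2 of the leads of
stmt-CriticalPhenomena-7029): for every conformal rectangle the annealed flip sum is small
uniformly in the leg parameter, `∃ η → 0 (δ → 0⁺), ∀ δ ∈ (0,1), ∀ t ∈ [0,1], |flipSum R t δ| ≤ η δ`.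
With the landed `uniform_close_annealed_flipLeg_of_kernel_bound` it yields uniform closeness of
`legProb R · δ` on `[0,1]`, hence Cardy at `t = 1` (`G_s`) from Cardy at `t = ½`.  (A statement POSITED by the route — the
informal crux item on this leg — not a literature fact; deliberately untagged.) -/
def QuadrupoleSelectionRuleBits : Prop :=
  ∀ R : ConformalRectangle, ∃ η : ℝ → ℝ, Tendsto η (𝓝[>] 0) (𝓝 0) ∧
    ∀ δ : ℝ, 0 < δ → δ < 1 → ∀ t ∈ Icc (0 : ℝ) 1, |flipSum R t δ| ≤ η δ

/-- **PairRate θ** — the crux proper on the bits leg, normalisation-free: for every conformal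
rectangle there are `C₀ > 0`, `C ≥ 0` such that for every mesh `δ ∈ (0,1)`, leg parameter
`t ∈ [0,1]` and every quarter-turn pair of faces at depth `d > C₀ δ`, the two annealed flip
responses cancel to relative order `(δ/d)^θ` against their own four-arm weights.  (Posited by
the route; open; deliberately untagged.) -/
def PairRate (θ : ℝ) : Prop :=
  ∀ R : ConformalRectangle, ∃ C₀ : ℝ, 0 < C₀ ∧ ∃ C : ℝ, 0 ≤ C ∧
    ∀ δ : ℝ, 0 < δ → δ < 1 → ∀ t ∈ Icc (0 : ℝ) 1, ∀ x : ℤ × ℤ, C₀ * δ < depth R δ x →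
      |faceResponse R t δ (x, false) + faceResponse R t δ (x, true)| ≤
        C * (δ / depth R δ x) ^ θ * (armWeight R t δ (x, false) + armWeight R t δ (x, true))

/-- **ArmBudget θ** — the a-priori arm estimate: for every conformal rectangle and every
cut-off constant `C₀ > 0`, the cut-off-weighted sum of the four-arm weights over the faces tends
to `0` with the mesh, uniformly in the leg parameter.  (Posited by the route; open; deliberately
untagged.) -/
def ArmBudget (θ : ℝ) : Prop :=
  ∀ R : ConformalRectangle, ∀ C₀ : ℝ, 0 < C₀ → ∃ η : ℝ → ℝ, Tendsto η (𝓝[>] 0) (𝓝 0) ∧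
    ∀ δ : ℝ, 0 < δ → δ < 1 → ∀ t ∈ Icc (0 : ℝ) 1,
      ∑ k ∈ faces R δ, cutoff C₀ θ δ (depth R δ k.1) * armWeight R t δ k ≤ η δ

/-! ### Bookkeeping identities consumed by the Russo formula and the reduction -/

/-- `GammaMesh` reads only the bits in the box (hypothesis `hΓ` of the Russo formula). [folklore] -/
theorem gammaMesh_inter (R : ConformalRectangle) (δ : ℝ) (τ : Set Face) :
    GammaMesh R δ τ = GammaMesh R δ (τ ∩ ↑(faces R δ)) := by
  simp [GammaMesh, Set.inter_assoc]

/-- Switching a box bit is the diagonal flip (hypothesis `hflip` of the Russo formula). [folklore] -/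
theorem gammaMesh_insert (R : ConformalRectangle) (δ : ℝ) (τ : Set Face) (k : Face)
    (hk : k ∈ faces R δ) :
    GammaMesh R δ (insert k τ) =
      flipGraph (GammaMesh R δ (τ \ {k})) (fA k) (fB k) (fC k) (fD k) := by
  have h1 : insert k τ ∩ ↑(faces R δ) = insert k (τ ∩ ↑(faces R δ)) := by
    ext k'
    simp only [Set.mem_inter_iff, Set.mem_insert_iff, Finset.mem_coe]
    constructor
    · rintro ⟨rfl | h, h'⟩
      · exact Or.inl rfl
      · exact Or.inr ⟨h, h'⟩
    · rintro (rfl | ⟨h, h'⟩)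
      · exact ⟨Or.inl rfl, hk⟩
      · exact ⟨Or.inr h, h'⟩
  have h2 : (τ \ {k}) ∩ ↑(faces R δ) = (τ ∩ ↑(faces R δ)) \ {k} := by
    ext k'
    simp only [Set.mem_inter_iff, Set.mem_sdiff, Set.mem_singleton_iff, Finset.mem_coe]
    tauto
  rw [GammaMesh, GammaMesh, h1, h2]
  exact gamma_insert_eq_flipGraph _ k

/-- The graph with face `k` removed reads only the bits in the box. [folklore] -/
theorem gammaMesh_sdiff_eq (R : ConformalRectangle) (δ : ℝ) (k : Face) (τ : Set Face) :
    GammaMesh R δ (τ \ {k}) = GammaMesh R δ ((τ ∩ ↑(faces R δ)) \ {k}) := by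
  rw [gammaMesh_inter R δ (τ \ {k}), gammaMesh_inter R δ ((τ ∩ ↑(faces R δ)) \ {k})]
  congr 1
  ext i
  simp only [Set.mem_inter_iff, Set.mem_sdiff, Set.mem_singleton_iff, Finset.mem_coe]
  tauto

/-- Regrouping a sum over the faces of the box into quarter-turn pairs. [folklore] -/
theorem sum_faces_eq_sum_pairs (R : ConformalRectangle) (δ : ℝ) (f : Face → ℝ) :
    ∑ k ∈ faces R δ, f k = ∑ x ∈ box R δ, (f (x, false) + f (x, true)) := by
  unfold faces
  rw [Finset.sum_product]
  refine Finset.sum_congr rfl fun x _ => ?_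
  rw [Fintype.sum_bool, add_comm]

/-! ### The two halves of the arm budget (appended 2026-08-17, lead c2 cycle 2) -/

/-- **BulkArm ε** — "the four-arm exponent exceeds `1` uniformly along the leg": for every
conformal rectangle and every bulk depth `r₀ > 0` there is `C` such that every face at depth
`≥ r₀` has annealed four-arm weight at most `C δ^{1+ε}`, for all meshes `δ ∈ (0,1)` and all leg
parameters `t ∈ [0,1]`.  (For a fixed lattice with RSW this is `α₄ ≥ 1 + α₂/2 > 1`, van den Berg–
Nolin 2021; here it is posited uniformly along the annealed leg.  Posited by the route; open;
deliberately untagged.) -/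
def BulkArm (ε : ℝ) : Prop :=
  ∀ R : ConformalRectangle, ∀ r₀ : ℝ, 0 < r₀ → ∃ C : ℝ, ∀ δ : ℝ, 0 < δ → δ < 1 →
    ∀ t ∈ Icc (0 : ℝ) 1, ∀ k ∈ faces R δ, r₀ ≤ depth R δ k.1 → armWeight R t δ k ≤ C * δ ^ (1 + ε)

/-- **LayerArm** — "boundary layers carry vanishing weight": for every conformal rectangle and
every `η > 0` there are a depth `r₀ > 0` and a mesh `δ₁ > 0` such that the total annealed four-arm
weight of the faces at depth `< r₀` is at most `η` for all `δ ∈ (0, δ₁)` and all `t ∈ [0,1]`.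
(Posited by the route; open; deliberately untagged.) -/
def LayerArm : Prop :=
  ∀ R : ConformalRectangle, ∀ η : ℝ, 0 < η → ∃ r₀ : ℝ, 0 < r₀ ∧ ∃ δ₁ : ℝ, 0 < δ₁ ∧
    ∀ δ : ℝ, 0 < δ → δ < δ₁ → ∀ t ∈ Icc (0 : ℝ) 1,
      ∑ k ∈ (faces R δ).filter (fun k => depth R δ k.1 < r₀), armWeight R t δ k ≤ η

/-- The number of faces read at mesh `δ` is `2 (2 boxN + 1)²`. [folklore] -/
theorem card_faces : ∀ (R : Literature.Probability.RandomPlanarGeometry.ConformalRectangle) (δ : ℝ),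
    (Summit.CriticalPhenomena.CardyFormulaZ2.Theorems.BitsLeg.faces R δ).card =
      2 * (2 * Summit.CriticalPhenomena.CardyFormulaZ2.Theorems.BitsLeg.boxN R δ + 1) ^ 2 := by
  intro R δ
  rw [faces, Finset.card_product, box, Finset.card_product, Int.card_Icc, Finset.card_univ,
    Fintype.card_bool]
  have h : (boxN R δ : ℤ) + 1 - -(boxN R δ : ℤ) = ((2 * boxN R δ + 1 : ℕ) : ℤ) := by push_cast; ring
  rw [h, Int.toNat_natCast]
  ring

end Summit.CriticalPhenomena.CardyFormulaZ2.Theorems.BitsLeg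

end
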